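import Summits.BirchSwinnertonDyer.BirchSwinnertonDyer.Theses.PlecticLegs
import Literature.NumberTheory.EllipticCurves.GaloisAction
import Literature.NumberTheory.EllipticCurves.Tamagawa

/-!
# `PlecticLegs.TwistSupply` (crux stmt-BirchSwinnertonDyer-18260), line `selmer-silencing`:
# the registered stub `stub_goodPrimePowerSupply` is MISSTATED — its "level prime to `S`" clause
# `∀ q ∈ S, Nat.Coprime q m` is unsatisfiable together with `orderOf χ = ℓ ^ n` as soon as `0 ∈ S`
# (negative-side support from the skeleton-vetting refuter seat; this file does NOT refute the crux)

The skeleton `Cruxes/TwistSupply/Lines/selmer_silencing.lean` (sha `e383dba0…`, registered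
2026-08-17) states its lever as

  `stub_goodPrimePowerSupply : ∀ W [W.IsElliptic] ℓ [Fact ℓ.Prime], 5 ≤ ℓ → (good, ordinary,
    non-anomalous, surjective mod ℓ) → ∀ n, 1 ≤ n → ∀ S : Finset ℕ, ∃ m (_ : NeZero m)
    (χ : DirichletCharacter ℂ m), (∀ q ∈ S, Nat.Coprime q m) ∧ χ.Even ∧ orderOf χ = ℓ ^ n ∧ …`.

`S : Finset ℕ` is meant to be a finite set of PRIMES to keep away from the level, but nothing says
so: with `0 ∈ S` the clause `Nat.Coprime 0 m` forces `m = 1` (`Nat.coprime_zero_left`), every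
Dirichlet character of level `1` is trivial (`DirichletCharacter.level_one`), so `orderOf χ = 1`,
contradicting `orderOf χ = ℓ ^ n ≥ 5`. Hence:

* `goodPrimePowerSupply_conclusion_false_of_zero_mem` — for ANY `W`, any `ℓ ^ n ≠ 1` and any `S ∋ 0`
  the stub's conclusion is unsatisfiable (unconditional, elementary);
* `stub_goodPrimePowerSupply_false_of_hyps` — the stub as registered (stated INLINE, verbatim) is
  false as soon as ONE pair `(W, ℓ)` meets its hypotheses (e.g. `37a1`, `ℓ = 5`: `a₅ = -2`, good
  ordinary non-anomalous reduction, `ρ̄_{E,5}` surjective — a witness the tree cannot yet construct,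
  `HasSurjectiveModNGaloisRep` being surjectivity of the genuine Galois action on `E[5](ℚ̄)`), i.e.
  unless it is vacuous.

The composition `TwistSupply_of` only ever instantiates `S := ∅`, so the line is unaffected by the
minimal repair: drop `∀ S` and the coprimality clause, or weaken it to
`∀ q ∈ S, q ≠ 0 → Nat.Coprime q m` (equivalently `S : Finset Nat.Primes`, or `∀ q ∈ S, ¬ q ∣ m`
with `1 ∉ S`). Moral for the lead / provers: do not attack `stub_goodPrimePowerSupply` as registered.
-/

noncomputable section

-- D-0017: single-problem summit, so `Summit.BirchSwinnertonDyer.BirchSwinnertonDyer.…` repeats a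
-- namespace BY DESIGN.
set_option linter.dupNamespace false

namespace Summit.BirchSwinnertonDyer.BirchSwinnertonDyer.Theorems.TwistSupply.Negative

open WeierstrassCurve Literature.NumberTheory.EllipticCurves

/-- **The conclusion of `stub_goodPrimePowerSupply` is unsatisfiable at any `S ∋ 0`**: a level `m`
coprime to `0` is `m = 1`, and the only Dirichlet character of level `1` is trivial, of order
`1 ≠ ℓ ^ n`. Unconditional; holds for every curve `W` (the `L`-value clause is never reached).
[folklore] -/
theorem goodPrimePowerSupply_conclusion_false_of_zero_mem (W : WeierstrassCurve ℚ) (ℓ n : ℕ)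
    (hℓn : ℓ ^ n ≠ 1) (S : Finset ℕ) (h0 : 0 ∈ S) :
    ¬ ∃ (m : ℕ) (_ : NeZero m) (χ : DirichletCharacter ℂ m),
        (∀ q ∈ S, Nat.Coprime q m) ∧ χ.Even ∧ orderOf χ = ℓ ^ n ∧
        ∀ j : ℕ, χ ^ j ≠ 1 →
          ∃ L : ℂ → ℂ, Differentiable ℂ L ∧
            (∀ s : ℂ, 2 < s.re →
              L s = LSeries (fun k ↦ (χ ^ j) k * ((W.LFunction k : ℤ) : ℂ)) s) ∧ L 1 ≠ 0 := by
  rintro ⟨m, _, χ, hS, -, hord, -⟩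
  obtain rfl : m = 1 := (Nat.coprime_zero_left m).mp (hS 0 h0)
  rw [DirichletCharacter.level_one χ, orderOf_one] at hord
  exact hℓn hord.symm

/-- **`stub_goodPrimePowerSupply` (as registered, stated inline verbatim) is false unless vacuous**:
one pair `(W, ℓ)` satisfying its hypotheses (`ℓ ≥ 5` prime of good ordinary non-anomalous reduction
with surjective mod-`ℓ` representation) refutes it, via `n = 1`, `S = {0}` and
`goodPrimePowerSupply_conclusion_false_of_zero_mem`. The hypothesis is not constructible in the tree
today (no concrete instance of `HasSurjectiveModNGaloisRep`), so this is a negative lemma modulo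
inhabitation, not a refutation; the repair is to drop / restrict the `S`-clause (module docstring).
[folklore] -/
theorem stub_goodPrimePowerSupply_false_of_hyps
    (hinh : ∃ (W : WeierstrassCurve ℚ) (_ : W.IsElliptic) (ℓ : ℕ) (_ : Fact ℓ.Prime),
      5 ≤ ℓ ∧ W.HasGoodReductionAtPrime ℓ ∧ ¬ (ℓ : ℤ) ∣ W.LFunction ℓ ∧
        ((W.LFunction ℓ : ℤ) : ZMod ℓ) ≠ 1 ∧ W.HasSurjectiveModNGaloisRep (ℓ : ℤ)) :
    ¬ ∀ (W : WeierstrassCurve ℚ) [W.IsElliptic] (ℓ : ℕ) [Fact ℓ.Prime],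
        5 ≤ ℓ → W.HasGoodReductionAtPrime ℓ → ¬ (ℓ : ℤ) ∣ W.LFunction ℓ →
        ((W.LFunction ℓ : ℤ) : ZMod ℓ) ≠ 1 → W.HasSurjectiveModNGaloisRep (ℓ : ℤ) →
        ∀ n : ℕ, 1 ≤ n → ∀ S : Finset ℕ,
          ∃ (m : ℕ) (_ : NeZero m) (χ : DirichletCharacter ℂ m),
            (∀ q ∈ S, Nat.Coprime q m) ∧ χ.Even ∧ orderOf χ = ℓ ^ n ∧
            ∀ j : ℕ, χ ^ j ≠ 1 →
              ∃ L : ℂ → ℂ, Differentiable ℂ L ∧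
                (∀ s : ℂ, 2 < s.re →
                  L s = LSeries (fun k ↦ (χ ^ j) k * ((W.LFunction k : ℤ) : ℂ)) s) ∧ L 1 ≠ 0 := by
  intro hstub
  obtain ⟨W, hW, ℓ, hℓ, h5, hgood, hord, hna, hsurj⟩ := hinh
  have hℓ1 : ℓ ^ 1 ≠ 1 := by
    rw [pow_one]
    omega
  exact goodPrimePowerSupply_conclusion_false_of_zero_mem W ℓ 1 hℓ1 {0} (Finset.mem_singleton_self 0)
    (hstub W ℓ h5 hgood hord hna hsurj 1 le_rfl {0})

/-- The same obstruction bites every level-avoiding variant that lets `S` contain `0`, but NOT the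
repaired clause `∀ q ∈ S, q ≠ 0 → Nat.Coprime q m`: for any finite `S` and any `M ≥ 1` there is a
modulus `m ≥ M` coprime to every non-zero element of `S` (take `m = (∏_{q ∈ S, q ≠ 0} q) * k + 1`),
so the repaired side condition is always satisfiable — recorded here as the sanity check that the
proposed repair removes exactly the degenerate case. [folklore] -/
theorem exists_coprime_nonzero_of_finset (S : Finset ℕ) (M : ℕ) :
    ∃ m : ℕ, M ≤ m ∧ ∀ q ∈ S, q ≠ 0 → Nat.Coprime q m := by
  refine ⟨(S.filter (· ≠ 0)).prod id * (M + 1) + 1, ?_, ?_⟩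
  · have hpos : 0 < (S.filter (· ≠ 0)).prod id :=
      Finset.prod_pos fun q hq ↦ Nat.pos_of_ne_zero (Finset.mem_filter.mp hq).2
    nlinarith
  · intro q hq hq0
    have hdvd : q ∣ (S.filter (· ≠ 0)).prod id :=
      Finset.dvd_prod_of_mem id (Finset.mem_filter.mpr ⟨hq, hq0⟩)
    obtain ⟨c, hc⟩ := hdvd
    rw [hc, mul_assoc]
    exact (Nat.coprime_mul_left_add_right q 1 (c * (M + 1))).mpr (Nat.coprime_one_right q)

end Summit.BirchSwinnertonDyer.BirchSwinnertonDyer.Theorems.TwistSupply.Negative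

end
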